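import Summits.Ventures.PercRepro.C041TriDomExcessSymm

/-!
# ROW C-041 — THE EQUALITY CASE OF THE EXCESS, I: PRESENT EDGES, SEPARATION, AND THE SIDE OF A CUT VERTEX
(p6, gen 43; P6-TWOEXIT-LEAN.md §53 ADDENDUM 2, the kernel half `(⇐)`, part I of II)

The excess `e = N_RRa − N_RB − N_WRj − N_RWj` of a three-marked host (`excess`, THEOREM (THE EXCESS IS
NON-NEGATIVE) `excess_nonneg`) VANISHES on the SEPARABLE hosts: those whose three marks are not all connected, and
those in which one mark SEPARATES the other two (every walk between them passes through it; coincident marks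
included).  Everything is set up for an arbitrary STATUS `st` (free / absent / double edges, `C041TriDomExcessStatus`).

* `PAdjS` is the adjacency through PRESENT edges (status `≠ absent`), `PConn` its connectivity, `side st a c` the
  `c`-side of `a` (the vertices reachable from `c` by present edges avoiding `a`), `SepS st a b c` the separation
  `b = a ∨ c = a ∨ b ∉ side st a c`, `SeparableS` the disjunction of «not all connected» and the three separations.
* NOT ALL CONNECTED (`esym_eq_zero_of_not_conn`): every non-zero value of `Fsym` needs two of the three pairs connected
  in some colour, hence all three by present edges (`Fsym_zero_first`, `Fsym_zero_second`, two `decide`s).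
* THE SIDE OF A CUT VERTEX: a walk from `a` to a vertex OFF the `c`-side `C` of `a` lives on the edges not touching
  `C` (`rtg_out`), a walk from `a` INTO `C` on the edges touching `C` (`rtg_in`), and a walk from a vertex off `C`
  into `C` passes through `a` (`rtg_through`) — by induction on `Relation.ReflTransGen`, using that `C` is closed
  under present edges not ending at `a` (`side_closed`).
* THE SIDE FLIP `flipT C` complements the colours of the edges touching `C` (an involution of the colourings; on an
  edge touching `C` red after the flip is blue before, `redE_flipT_of_touches`).
* Part II (`C041TriDomExcessZero`): the adjacencies under the flip and THEOREM (SEPARABLE ⟹ THE EXCESS VANISHES).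
-/

namespace PercRepro

namespace ZoneZ

namespace MultiExit

open ZoneData Finset

variable {V₁ E₁ U₁ U₂ : Type} (Z₁ : ZoneData V₁ E₁ U₁ U₂) (u u' a₁ : V₁)

/-! ## Present edges, connectivity and separation -/

/-- The edge `e` is present under the status `st` (not deleted). -/
def presE (st : E₁ → EStat) (e : E₁) : Prop := st e ≠ .absent

/-- Adjacency through an edge satisfying the predicate `col`. -/
def AdjCol (col : E₁ → Prop) (x y : V₁) : Prop := ∃ e, Z₁.Joins e x y ∧ col e

/-- Adjacency through a present edge. -/
def PAdjS (st : E₁ → EStat) (x y : V₁) : Prop := AdjCol Z₁ (presE st) x y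

/-- Present adjacency avoiding the vertex `a`. -/
def PAdjAvoid (st : E₁ → EStat) (a x y : V₁) : Prop := PAdjS Z₁ st x y ∧ x ≠ a ∧ y ≠ a

/-- `v` is connected to `k` by present edges. -/
def PConn (st : E₁ → EStat) (k v : V₁) : Prop := v ∈ ZoneData.reach (PAdjS Z₁ st) {k}

/-- The `c`-side of `a`: the vertices reachable from `c` by present edges avoiding `a`. -/
def side (st : E₁ → EStat) (a c : V₁) : Set V₁ := ZoneData.reach (PAdjAvoid Z₁ st a) {c}

/-- `a` SEPARATES `b` from `c`: every present walk from `c` to `b` passes through `a` (coincidences included). -/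
def SepS (st : E₁ → EStat) (a b c : V₁) : Prop := b = a ∨ c = a ∨ b ∉ side Z₁ st a c

/-- The three marks are connected by present edges. -/
def ConnS (st : E₁ → EStat) : Prop := PConn Z₁ st a₁ u ∧ PConn Z₁ st a₁ u'

/-- The host under the status `st` is SEPARABLE for the marks `a₁, u, u'`: the marks are not all connected, or one of
them separates the other two. -/
def SeparableS (st : E₁ → EStat) : Prop :=
  ¬ ConnS Z₁ u u' a₁ st ∨ SepS Z₁ st a₁ u u' ∨ SepS Z₁ st u a₁ u' ∨ SepS Z₁ st u' a₁ u

/-- The red adjacency is the adjacency through the red edges. -/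
theorem RAdjS_eq_AdjCol (st : E₁ → EStat) (ω : E₁ → Bool) : RAdjS Z₁ st ω = AdjCol Z₁ (redE st ω) := rfl

/-- The blue adjacency is the adjacency through the blue edges. -/
theorem BAdjS_eq_AdjCol (st : E₁ → EStat) (ω : E₁ → Bool) : BAdjS Z₁ st ω = AdjCol Z₁ (blueE st ω) := rfl

/-- A red edge is present. -/
theorem redE_pres {st : E₁ → EStat} {ω : E₁ → Bool} {e : E₁} (h : redE st ω e) : presE st e := by
  unfold presE
  rcases h with h | h
  · rw [h]; decide
  · rw [h.1]; decide

/-- A blue edge is present. -/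
theorem blueE_pres {st : E₁ → EStat} {ω : E₁ → Bool} {e : E₁} (h : blueE st ω e) : presE st e := by
  unfold presE
  rcases h with h | h
  · rw [h]; decide
  · rw [h.1]; decide

/-- Adjacency is monotone in the edge predicate. -/
theorem AdjCol_mono {col col' : E₁ → Prop} (h : ∀ e, col e → col' e) (x y : V₁) (hxy : AdjCol Z₁ col x y) :
    AdjCol Z₁ col' x y := by
  obtain ⟨e, he, hc⟩ := hxy
  exact ⟨e, he, h e hc⟩

/-- Adjacency is symmetric. -/
theorem AdjCol_symm (col : E₁ → Prop) (x y : V₁) (hxy : AdjCol Z₁ col x y) : AdjCol Z₁ col y x := by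
  obtain ⟨e, he, hc⟩ := hxy
  exact ⟨e, Joins_symm Z₁ he, hc⟩

/-- Red connectivity is present connectivity. -/
theorem RdS_pconn {st : E₁ → EStat} {ω : E₁ → Bool} {k v : V₁} (h : RdS Z₁ st ω k v) : PConn Z₁ st k v :=
  reach_mono (fun x y hxy => AdjCol_mono Z₁ (fun _ he => redE_pres he) x y hxy) h

/-- Blue connectivity is present connectivity. -/
theorem MgS_pconn {st : E₁ → EStat} {ω : E₁ → Bool} {k v : V₁} (h : MgS Z₁ st ω k v) : PConn Z₁ st k v :=
  reach_mono (fun x y hxy => AdjCol_mono Z₁ (fun _ he => blueE_pres he) x y hxy) h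

/-- Present connectivity is symmetric. -/
theorem PConn_symm {st : E₁ → EStat} {k v : V₁} (h : PConn Z₁ st k v) : PConn Z₁ st v k :=
  reach_trans_of_symm (AdjCol_symm Z₁ (presE st)) h (mem_reach_self _ _)

/-- Present connectivity composes. -/
theorem PConn_trans {st : E₁ → EStat} {k x v : V₁} (h1 : PConn Z₁ st k x) (h2 : PConn Z₁ st x v) :
    PConn Z₁ st k v :=
  reach_trans' h1 h2

/-! ## Not all connected: the excess vanishes -/

/-- If the first pair is connected in neither colour and one of the other pairs in neither colour, `Fsym` vanishes. -/
theorem Fsym_zero_first : ∀ s t : P3, s.1 = false → t.1 = false →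
    ((s.2.1 = false ∧ t.2.1 = false) ∨ (s.2.2 = false ∧ t.2.2 = false)) → Fsym s t = 0 := by
  decide

/-- If the second pair is connected in neither colour and one of the other pairs in neither colour, `Fsym` vanishes. -/
theorem Fsym_zero_second : ∀ s t : P3, s.2.1 = false → t.2.1 = false →
    ((s.1 = false ∧ t.1 = false) ∨ (s.2.2 = false ∧ t.2.2 = false)) → Fsym s t = 0 := by
  decide

open Classical in
/-- The first coordinate of the red pattern is the decision of `a₁ ~ u`. -/
theorem rsig_fst (st : E₁ → EStat) (ω : E₁ → Bool) :
    (rsig Z₁ u u' a₁ st ω).1 = decide (RdS Z₁ st ω a₁ u) := rfl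

open Classical in
/-- The second coordinate of the red pattern is the decision of `a₁ ~ u'`. -/
theorem rsig_snd (st : E₁ → EStat) (ω : E₁ → Bool) :
    (rsig Z₁ u u' a₁ st ω).2.1 = decide (RdS Z₁ st ω a₁ u') := rfl

open Classical in
/-- The third coordinate of the red pattern is the decision of `u ~ u'`. -/
theorem rsig_thd (st : E₁ → EStat) (ω : E₁ → Bool) :
    (rsig Z₁ u u' a₁ st ω).2.2 = decide (RdS Z₁ st ω u u') := rfl

open Classical in
/-- The first coordinate of the blue pattern is the decision of `a₁ ~ u`. -/
theorem bsig_fst (st : E₁ → EStat) (ω : E₁ → Bool) :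
    (bsig Z₁ u u' a₁ st ω).1 = decide (MgS Z₁ st ω a₁ u) := rfl

open Classical in
/-- The second coordinate of the blue pattern is the decision of `a₁ ~ u'`. -/
theorem bsig_snd (st : E₁ → EStat) (ω : E₁ → Bool) :
    (bsig Z₁ u u' a₁ st ω).2.1 = decide (MgS Z₁ st ω a₁ u') := rfl

open Classical in
/-- The third coordinate of the blue pattern is the decision of `u ~ u'`. -/
theorem bsig_thd (st : E₁ → EStat) (ω : E₁ → Bool) :
    (bsig Z₁ u u' a₁ st ω).2.2 = decide (MgS Z₁ st ω u u') := rfl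

/-- If the marks are not all connected by present edges, every colouring contributes `0`. -/
theorem Fsym_eq_zero_of_not_conn (st : E₁ → EStat) (h : ¬ ConnS Z₁ u u' a₁ st) (ω : E₁ → Bool) :
    Fsym (rsig Z₁ u u' a₁ st ω) (bsig Z₁ u u' a₁ st ω) = 0 := by
  unfold ConnS at h
  rw [not_and_or] at h
  rcases h with h | h
  · -- `a₁ ≁ u`
    refine Fsym_zero_first _ _ ?_ ?_ ?_
    · rw [rsig_fst, decide_eq_false_iff_not]; exact fun hr => h (RdS_pconn Z₁ hr)
    · rw [bsig_fst, decide_eq_false_iff_not]; exact fun hb => h (MgS_pconn Z₁ hb)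
    · by_cases h2 : PConn Z₁ st a₁ u'
      · right
        have h3 : ¬ PConn Z₁ st u u' := fun h3 => h (PConn_trans Z₁ h2 (PConn_symm Z₁ h3))
        constructor
        · rw [rsig_thd, decide_eq_false_iff_not]; exact fun hr => h3 (RdS_pconn Z₁ hr)
        · rw [bsig_thd, decide_eq_false_iff_not]; exact fun hb => h3 (MgS_pconn Z₁ hb)
      · left
        constructor
        · rw [rsig_snd, decide_eq_false_iff_not]; exact fun hr => h2 (RdS_pconn Z₁ hr)
        · rw [bsig_snd, decide_eq_false_iff_not]; exact fun hb => h2 (MgS_pconn Z₁ hb)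
  · -- `a₁ ≁ u'`
    refine Fsym_zero_second _ _ ?_ ?_ ?_
    · rw [rsig_snd, decide_eq_false_iff_not]; exact fun hr => h (RdS_pconn Z₁ hr)
    · rw [bsig_snd, decide_eq_false_iff_not]; exact fun hb => h (MgS_pconn Z₁ hb)
    · by_cases h2 : PConn Z₁ st a₁ u
      · right
        have h3 : ¬ PConn Z₁ st u u' := fun h3 => h (PConn_trans Z₁ h2 h3)
        constructor
        · rw [rsig_thd, decide_eq_false_iff_not]; exact fun hr => h3 (RdS_pconn Z₁ hr)
        · rw [bsig_thd, decide_eq_false_iff_not]; exact fun hb => h3 (MgS_pconn Z₁ hb)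
      · left
        constructor
        · rw [rsig_fst, decide_eq_false_iff_not]; exact fun hr => h2 (RdS_pconn Z₁ hr)
        · rw [bsig_fst, decide_eq_false_iff_not]; exact fun hb => h2 (MgS_pconn Z₁ hb)

variable [DecidableEq E₁] [Fintype E₁]

open Classical in
/-- **NOT ALL CONNECTED ⟹ `esym = 0`.** -/
theorem esym_eq_zero_of_not_conn (st : E₁ → EStat) (h : ¬ ConnS Z₁ u u' a₁ st) : esym Z₁ u u' a₁ st = 0 := by
  unfold esym
  exact Finset.sum_eq_zero fun ω _ => Fsym_eq_zero_of_not_conn Z₁ u u' a₁ st h ω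

/-! ## The side of a separating vertex -/

omit [DecidableEq E₁] [Fintype E₁] in
/-- A vertex on the `c`-side of `a` is not `a` (when `c ≠ a`). -/
theorem ne_of_mem_side {st : E₁ → EStat} {a c x : V₁} (hc : c ≠ a) (hx : x ∈ side Z₁ st a c) : x ≠ a := by
  unfold side at hx
  rw [mem_reach_singleton] at hx
  induction hx with
  | refl => exact hc
  | tail _ hxy _ => exact hxy.2.2

omit [DecidableEq E₁] [Fintype E₁] in
/-- The side is closed under present edges that do not end at `a`. -/
theorem side_closed {st : E₁ → EStat} {a c x y : V₁} (hc : c ≠ a) (hx : x ∈ side Z₁ st a c) {e : E₁}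
    (he : presE st e) (hxy : Z₁.Joins e x y) (hy : y ≠ a) : y ∈ side Z₁ st a c := by
  have hxa := ne_of_mem_side Z₁ hc hx
  unfold side at hx ⊢
  rw [mem_reach_singleton] at hx ⊢
  exact hx.tail ⟨⟨e, hxy, he⟩, hxa, hy⟩

omit [DecidableEq E₁] [Fintype E₁] in
/-- An edge joining `x` and `y` touches `C` iff one of them lies in `C`. -/
theorem touches_iff_of_joins (C : Set V₁) {e : E₁} {x y : V₁} (h : Z₁.Joins e x y) :
    Z₁.Touches C e ↔ (x ∈ C ∨ y ∈ C) := by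
  unfold ZoneData.Touches
  rcases h with ⟨h1, h2⟩ | ⟨h1, h2⟩
  · rw [h1, h2]
  · rw [h1, h2, or_comm]

/-- Adjacency through a `col`-edge NOT touching `C`. -/
def AdjColOut (C : Set V₁) (col : E₁ → Prop) (x y : V₁) : Prop := ∃ e, Z₁.Joins e x y ∧ col e ∧ ¬ Z₁.Touches C e

/-- Adjacency through a `col`-edge touching `C`. -/
def AdjColIn (C : Set V₁) (col : E₁ → Prop) (x y : V₁) : Prop := ∃ e, Z₁.Joins e x y ∧ col e ∧ Z₁.Touches C e

omit [DecidableEq E₁] [Fintype E₁] in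
/-- A walk from `a` to a vertex off the `c`-side of `a` lives on the edges not touching that side. -/
theorem rtg_out {st : E₁ → EStat} {a c : V₁} (hc : c ≠ a) {col : E₁ → Prop} (hcol : ∀ e, col e → presE st e)
    {v : V₁} (h : Relation.ReflTransGen (AdjCol Z₁ col) a v) :
    v ∉ side Z₁ st a c → Relation.ReflTransGen (AdjColOut Z₁ (side Z₁ st a c) col) a v := by
  induction h with
  | refl => intro _; exact Relation.ReflTransGen.refl
  | @tail w v _ hwv ih =>
    intro hv
    obtain ⟨e, hj, hce⟩ := hwv
    by_cases hw : w ∈ side Z₁ st a c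
    · obtain rfl : v = a := by
        by_contra hne
        exact hv (side_closed Z₁ hc hw (hcol e hce) hj hne)
      exact Relation.ReflTransGen.refl
    · refine (ih hw).tail ⟨e, hj, hce, ?_⟩
      rw [touches_iff_of_joins Z₁ _ hj]
      rintro (h | h)
      · exact hw h
      · exact hv h

omit [DecidableEq E₁] [Fintype E₁] in
/-- A walk from `a` into the `c`-side of `a` lives on the edges touching that side. -/
theorem rtg_in {st : E₁ → EStat} {a c : V₁} (hc : c ≠ a) {col : E₁ → Prop} (hcol : ∀ e, col e → presE st e)
    {v : V₁} (h : Relation.ReflTransGen (AdjCol Z₁ col) a v) :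
    v ∈ side Z₁ st a c → Relation.ReflTransGen (AdjColIn Z₁ (side Z₁ st a c) col) a v := by
  induction h with
  | refl => intro _; exact Relation.ReflTransGen.refl
  | @tail w v _ hwv ih =>
    intro hv
    obtain ⟨e, hj, hce⟩ := hwv
    have ht : Z₁.Touches (side Z₁ st a c) e := by
      rw [touches_iff_of_joins Z₁ _ hj]; exact Or.inr hv
    by_cases hw : w ∈ side Z₁ st a c
    · exact (ih hw).tail ⟨e, hj, hce, ht⟩
    · obtain rfl : w = a := by
        by_contra hne
        exact hw (side_closed Z₁ hc hv (hcol e hce) (Joins_symm Z₁ hj) hne)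
      exact Relation.ReflTransGen.single ⟨e, hj, hce, ht⟩

omit [DecidableEq E₁] [Fintype E₁] in
/-- A walk from a vertex off the `c`-side of `a` into that side passes through `a`. -/
theorem rtg_through {st : E₁ → EStat} {a c : V₁} (hc : c ≠ a) {col : E₁ → Prop} (hcol : ∀ e, col e → presE st e)
    {k v : V₁} (hk : k ∉ side Z₁ st a c) (h : Relation.ReflTransGen (AdjCol Z₁ col) k v) :
    v ∈ side Z₁ st a c →
      Relation.ReflTransGen (AdjCol Z₁ col) k a ∧ Relation.ReflTransGen (AdjCol Z₁ col) a v := by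
  induction h with
  | refl => intro hk'; exact absurd hk' hk
  | @tail w v hw hwv ih =>
    intro hv
    by_cases hwC : w ∈ side Z₁ st a c
    · exact ⟨(ih hwC).1, (ih hwC).2.tail hwv⟩
    · obtain ⟨e, hj, hce⟩ := hwv
      obtain rfl : w = a := by
        by_contra hne
        exact hwC (side_closed Z₁ hc hv (hcol e hce) (Joins_symm Z₁ hj) hne)
      exact ⟨hw, Relation.ReflTransGen.single ⟨e, hj, hce⟩⟩

omit [DecidableEq E₁] [Fintype E₁] in
/-- Off the side, connectivity from `a` is connectivity through the edges not touching the side. -/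
theorem rtg_iff_out {st : E₁ → EStat} {a c : V₁} (hc : c ≠ a) {col : E₁ → Prop} (hcol : ∀ e, col e → presE st e)
    {v : V₁} (hv : v ∉ side Z₁ st a c) :
    Relation.ReflTransGen (AdjCol Z₁ col) a v ↔ Relation.ReflTransGen (AdjColOut Z₁ (side Z₁ st a c) col) a v := by
  refine ⟨fun h => rtg_out Z₁ hc hcol h hv, fun h => ?_⟩
  clear hv
  induction h with
  | refl => exact Relation.ReflTransGen.refl
  | tail _ hwv ih =>
    obtain ⟨e, hj, hce, _⟩ := hwv
    exact ih.tail ⟨e, hj, hce⟩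

omit [DecidableEq E₁] [Fintype E₁] in
/-- Into the side, connectivity from `a` is connectivity through the edges touching the side. -/
theorem rtg_iff_in {st : E₁ → EStat} {a c : V₁} (hc : c ≠ a) {col : E₁ → Prop} (hcol : ∀ e, col e → presE st e)
    {v : V₁} (hv : v ∈ side Z₁ st a c) :
    Relation.ReflTransGen (AdjCol Z₁ col) a v ↔ Relation.ReflTransGen (AdjColIn Z₁ (side Z₁ st a c) col) a v := by
  refine ⟨fun h => rtg_in Z₁ hc hcol h hv, fun h => ?_⟩
  clear hv
  induction h with
  | refl => exact Relation.ReflTransGen.refl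
  | tail _ hwv ih =>
    obtain ⟨e, hj, hce, _⟩ := hwv
    exact ih.tail ⟨e, hj, hce⟩


/-! ## The side flip -/

open Classical in
/-- THE SIDE FLIP: complement the colours of the edges touching `C`. -/
noncomputable def flipT (C : Set V₁) (ω : E₁ → Bool) : E₁ → Bool := fun e =>
  if Z₁.Touches C e then !ω e else ω e

omit [DecidableEq E₁] [Fintype E₁] in
/-- An edge touching `C` is complemented. -/
theorem flipT_of_touches (C : Set V₁) (ω : E₁ → Bool) {e : E₁} (h : Z₁.Touches C e) : flipT Z₁ C ω e = !ω e := by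
  unfold flipT
  rw [if_pos h]

omit [DecidableEq E₁] [Fintype E₁] in
/-- An edge not touching `C` keeps its colour. -/
theorem flipT_of_not_touches (C : Set V₁) (ω : E₁ → Bool) {e : E₁} (h : ¬ Z₁.Touches C e) :
    flipT Z₁ C ω e = ω e := by
  unfold flipT
  rw [if_neg h]

omit [DecidableEq E₁] [Fintype E₁] in
/-- The side flip is an involution. -/
theorem flipT_involutive (C : Set V₁) : Function.Involutive (flipT Z₁ C) := by
  intro ω
  funext e
  by_cases h : Z₁.Touches C e
  · rw [flipT_of_touches Z₁ C _ h, flipT_of_touches Z₁ C ω h, Bool.not_not]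
  · rw [flipT_of_not_touches Z₁ C _ h, flipT_of_not_touches Z₁ C ω h]

omit [DecidableEq E₁] [Fintype E₁] in
/-- On an edge touching `C`, red after the flip is blue before. -/
theorem redE_flipT_of_touches (st : E₁ → EStat) (C : Set V₁) (ω : E₁ → Bool) {e : E₁} (h : Z₁.Touches C e) :
    redE st (flipT Z₁ C ω) e ↔ blueE st ω e := by
  unfold redE blueE
  rw [flipT_of_touches Z₁ C ω h]
  cases ω e <;> simp

omit [DecidableEq E₁] [Fintype E₁] in
/-- On an edge touching `C`, blue after the flip is red before. -/
theorem blueE_flipT_of_touches (st : E₁ → EStat) (C : Set V₁) (ω : E₁ → Bool) {e : E₁} (h : Z₁.Touches C e) :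
    blueE st (flipT Z₁ C ω) e ↔ redE st ω e := by
  unfold redE blueE
  rw [flipT_of_touches Z₁ C ω h]
  cases ω e <;> simp

omit [DecidableEq E₁] [Fintype E₁] in
/-- On an edge not touching `C`, red is unchanged by the flip. -/
theorem redE_flipT_of_not_touches (st : E₁ → EStat) (C : Set V₁) (ω : E₁ → Bool) {e : E₁}
    (h : ¬ Z₁.Touches C e) : redE st (flipT Z₁ C ω) e ↔ redE st ω e := by
  unfold redE
  rw [flipT_of_not_touches Z₁ C ω h]

omit [DecidableEq E₁] [Fintype E₁] in
/-- On an edge not touching `C`, blue is unchanged by the flip. -/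
theorem blueE_flipT_of_not_touches (st : E₁ → EStat) (C : Set V₁) (ω : E₁ → Bool) {e : E₁}
    (h : ¬ Z₁.Touches C e) : blueE st (flipT Z₁ C ω) e ↔ blueE st ω e := by
  unfold blueE
  rw [flipT_of_not_touches Z₁ C ω h]
end MultiExit

end ZoneZ

end PercRepro
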